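import Summits.MatrixMultiplication.OmegaCensus.STPPKernelListerDefs
import Summits.MatrixMultiplication.OmegaCensus.STPPThinFamilies
import Summits.MatrixMultiplication.OmegaCensus.STPPSumsetPacking
import Summits.MatrixMultiplication.OmegaCensus.STPPPatternMonotonicity
import Summits.MatrixMultiplication.OmegaCensus.STPPDisjointPacking

/-!
# ω-census (abelian STPP census): kernel lister — realisable size patterns and the list-sum LAWS behind the budgets (kernel)

HONEST FRAMING (pub-omega census; verbatim): lottery ticket; floor = certified bounds/negative ranges.
Census STRUCTURE (seat pub-omega-stpp-2 gen 29, 2026-08-29), family (b2).  Nothing here is progress on `ω`.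

`KLister.Realizable H P`: the size pattern `P : List Shape` (blocks `(|Aᵢ|,|Bᵢ|,|Cᵢ|)` in list order) is realised by a simultaneous-triple-product family of the
finite abelian group `H` with non-empty sets.  This file transports the tree's pattern laws to LIST SUMS over `P` — the form in which the kernel lister's
budgets (`St.fits`) and leaf filters are written: single-block admissibility (`Realizable.adm`), N2 packing (`Σab, Σbc, Σca ≤ |H|`: `STPPKneser.card_DU_*`),
representation count (`Σab + Σbc ≤ |H| + b_t` for every block `t`, three rotations: `CubeNB.n9`), the aligned block-volume law N16 (`vol t + Σ_{k≠t} q_k ≤ |H|`,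
three readings: `CubeNB.vol_add_sum_*`), and the rank law N7 in the tree's `paper` form (`Σ maxflat ≤ |H|` and `rlbPaper t + Σ_{k≠t} maxflat ≤ |H|`:
`STPPRank.sum_gain_le_card_of_isSTPP` / `rlbPaper_add_sum_gain_le_card_of_isSTPP` with the best direction per block).  These are the inputs of the
`SearchHypU` instance (misfit / prune / exhausted) in the soundness file.
-/

open Finset

namespace Summit.MatrixMultiplication.OmegaCensus.KLister

open Literature.Computability.AlgebraicComplexity STPPRank

variable {H : Type*} [AddCommGroup H] [Fintype H]

/-! ## Realisable patterns -/

/-- `P` is realised in `H`: an STPP family indexed by the positions of `P`, with non-empty sets of the prescribed cards. [folklore] -/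
structure Realizable (H : Type*) [AddCommGroup H] (P : List Shape) : Prop where
  /-- the realising family and its properties -/
  out : ∃ A B C : Fin P.length → Finset H, IsSTPP A B C ∧
    ∀ i, (A i).Nonempty ∧ (B i).Nonempty ∧ (C i).Nonempty ∧ #(A i) = (P.get i).1 ∧ #(B i) = (P.get i).2.1 ∧ #(C i) = (P.get i).2.2

/-- Sums over the positions of a list are list sums. [folklore] -/
theorem sum_get (P : List Shape) (f : Shape → ℕ) : ∑ i : Fin P.length, f (P.get i) = (P.map f).sum := by
  have e : (List.ofFn fun i : Fin P.length => f (P.get i)) = P.map f := by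
    conv_rhs => rw [← List.ofFn_get P]
    rw [List.map_ofFn]; rfl
  rw [← List.sum_ofFn, e]

/-- A member of a list is some `P.get i`. [folklore] -/
theorem exists_get_of_mem {P : List Shape} {t : Shape} (h : t ∈ P) : ∃ i : Fin P.length, P.get i = t := by
  obtain ⟨i, hi, rfl⟩ := List.getElem_of_mem h
  exact ⟨⟨i, hi⟩, rfl⟩

/-- Sum over `univ.erase j` of `f (P.get ·)` plus the `j`-th term is the list sum. [folklore] -/
theorem sum_erase_get (P : List Shape) (f : Shape → ℕ) (j : Fin P.length) :
    ∑ k ∈ univ.erase j, f (P.get k) + f (P.get j) = (P.map f).sum := by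
  rw [Finset.sum_erase_add _ _ (Finset.mem_univ j), sum_get]

namespace Realizable

variable {P : List Shape}

/-! ## Single blocks -/

/-- Every block of a realisable pattern is admissible: entries `≥ 1`, `ab, bc, ca, abc ≤ |H|`. [cite: CohnKleinbergSzegedyUmans2005, Def. 5.1] -/
theorem adm (h : Realizable H P) : ∀ t ∈ P, adm (Fintype.card H) t = true := by
  obtain ⟨A, B, C, hS, hc⟩ := h.out
  intro t ht
  obtain ⟨i, rfl⟩ := exists_get_of_mem ht
  obtain ⟨hA, hB, hC, ha, hb, hcc⟩ := hc i
  have hvol := stpp_card_mul_card_mul_card_le hS i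
  have h1 : 1 ≤ #(A i) := Finset.card_pos.2 hA
  have h2 : 1 ≤ #(B i) := Finset.card_pos.2 hB
  have h3 : 1 ≤ #(C i) := Finset.card_pos.2 hC
  rw [ha, hb, hcc] at hvol
  rw [ha] at h1; rw [hb] at h2; rw [hcc] at h3
  simp only [KLister.adm, pab, pbc, pca, svol, decide_eq_true_eq]
  refine ⟨h1, h2, h3, ?_, ?_, ?_, hvol⟩
  · calc (P.get i).1 * (P.get i).2.1 = (P.get i).1 * (P.get i).2.1 * 1 := by ring
      _ ≤ (P.get i).1 * (P.get i).2.1 * (P.get i).2.2 := Nat.mul_le_mul_left _ h3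
      _ ≤ _ := hvol
  · calc (P.get i).2.1 * (P.get i).2.2 = 1 * ((P.get i).2.1 * (P.get i).2.2) := by ring
      _ ≤ (P.get i).1 * ((P.get i).2.1 * (P.get i).2.2) := Nat.mul_le_mul_right _ h1
      _ = (P.get i).1 * (P.get i).2.1 * (P.get i).2.2 := by ring
      _ ≤ _ := hvol
  · calc (P.get i).1 * (P.get i).2.2 = (P.get i).1 * 1 * (P.get i).2.2 := by ring
      _ ≤ (P.get i).1 * (P.get i).2.1 * (P.get i).2.2 := Nat.mul_le_mul_right _ (Nat.mul_le_mul_left _ h2)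
      _ ≤ _ := hvol

/-! ## N2 packing -/

/-- `Σ ab ≤ |H|`. [cite: CohnKleinbergSzegedyUmans2005, Def. 5.1] -/
theorem sum_pab_le (h : Realizable H P) : (P.map pab).sum ≤ Fintype.card H := by
  classical
  obtain ⟨A, B, C, hS, hc⟩ := h.out
  have e := STPPKneser.card_DU_AB hS (fun i => (hc i).2.2.1) univ
  have hle : #(STPPKneser.DU A B univ) ≤ Fintype.card H := Finset.card_le_univ _
  rw [e] at hle
  rw [← sum_get]
  simpa [pab, (fun i => (hc i).2.2.2.1), (fun i => (hc i).2.2.2.2.1)] using hle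

/-- `Σ bc ≤ |H|`. [cite: CohnKleinbergSzegedyUmans2005, Def. 5.1] -/
theorem sum_pbc_le (h : Realizable H P) : (P.map pbc).sum ≤ Fintype.card H := by
  classical
  obtain ⟨A, B, C, hS, hc⟩ := h.out
  have e := STPPKneser.card_DU_BC hS (fun i => (hc i).1) univ
  have hle : #(STPPKneser.DU B C univ) ≤ Fintype.card H := Finset.card_le_univ _
  rw [e] at hle
  rw [← sum_get]
  simpa [pbc, (fun i => (hc i).2.2.2.2.1), (fun i => (hc i).2.2.2.2.2)] using hle

/-- `Σ ca ≤ |H|`. [cite: CohnKleinbergSzegedyUmans2005, Def. 5.1] -/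
theorem sum_pca_le (h : Realizable H P) : (P.map pca).sum ≤ Fintype.card H := by
  classical
  obtain ⟨A, B, C, hS, hc⟩ := h.out
  have e := STPPKneser.card_DU_AC hS (fun i => (hc i).2.1) univ
  have hle : #(STPPKneser.DU A C univ) ≤ Fintype.card H := Finset.card_le_univ _
  rw [e] at hle
  rw [← sum_get]
  simpa [pca, (fun i => (hc i).2.2.2.1), (fun i => (hc i).2.2.2.2.2)] using hle

/-! ## Representation count (three rotations) -/

/-- `Σab + Σbc ≤ |H| + b_t` for every block `t`. [cite: CohnKleinbergSzegedyUmans2005, Def. 5.1] -/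
theorem rep_b (h : Realizable H P) : ∀ t ∈ P, (P.map pab).sum + (P.map pbc).sum ≤ Fintype.card H + t.2.1 := by
  classical
  obtain ⟨A, B, C, hS, hc⟩ := h.out
  intro t ht
  obtain ⟨j, rfl⟩ := exists_get_of_mem ht
  have h9 := CubeNB.n9 hS (fun i => (hc i).1) (fun i => (hc i).2.2.1) j
  rw [← sum_get, ← sum_get, ← (hc j).2.2.2.2.1]
  simpa [pab, pbc, (fun i => (hc i).2.2.2.1), (fun i => (hc i).2.2.2.2.1), (fun i => (hc i).2.2.2.2.2)] using h9

/-- `Σbc + Σca ≤ |H| + c_t` for every block `t` (rotation `(B,C,A)`). [cite: CohnKleinbergSzegedyUmans2005, Def. 5.1] -/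
theorem rep_c (h : Realizable H P) : ∀ t ∈ P, (P.map pbc).sum + (P.map pca).sum ≤ Fintype.card H + t.2.2 := by
  classical
  obtain ⟨A, B, C, hS, hc⟩ := h.out
  intro t ht
  obtain ⟨j, rfl⟩ := exists_get_of_mem ht
  have h9 := CubeNB.n9 (stpp_rotate hS) (fun i => (hc i).2.1) (fun i => (hc i).1) j
  rw [← sum_get, ← sum_get, ← (hc j).2.2.2.2.2]
  have e : ∀ i, #(C i) * #(A i) = #(A i) * #(C i) := fun i => mul_comm _ _
  simp only [e] at h9
  simpa [pbc, pca, (fun i => (hc i).2.2.2.1), (fun i => (hc i).2.2.2.2.1), (fun i => (hc i).2.2.2.2.2)] using h9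

/-- `Σca + Σab ≤ |H| + a_t` for every block `t` (rotation `(C,A,B)`). [cite: CohnKleinbergSzegedyUmans2005, Def. 5.1] -/
theorem rep_a (h : Realizable H P) : ∀ t ∈ P, (P.map pca).sum + (P.map pab).sum ≤ Fintype.card H + t.1 := by
  classical
  obtain ⟨A, B, C, hS, hc⟩ := h.out
  intro t ht
  obtain ⟨j, rfl⟩ := exists_get_of_mem ht
  have h9 := CubeNB.n9 (stpp_rotate (stpp_rotate hS)) (fun i => (hc i).2.2.1) (fun i => (hc i).2.1) j
  rw [← sum_get, ← sum_get, ← (hc j).2.2.2.1]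
  have e : ∀ i, #(C i) * #(A i) = #(A i) * #(C i) := fun i => mul_comm _ _
  simp only [e] at h9
  simpa [pca, pab, (fun i => (hc i).2.2.2.1), (fun i => (hc i).2.2.2.2.1), (fun i => (hc i).2.2.2.2.2)] using h9

/-! ## N16, the aligned block-volume law (three readings) -/

/-- `vol t + Σ qc ≤ |H| + qc t` for every block `t` (`C`-reading: `vol t + Σ_{k≠t}(a_k+b_k)c_k ≤ |H|`). [cite: CohnKleinbergSzegedyUmans2005, Def. 5.1] -/
theorem n16_c (h : Realizable H P) : ∀ t ∈ P, svol t + (P.map qc).sum ≤ Fintype.card H + qc t := by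
  classical
  obtain ⟨A, B, C, hS, hc⟩ := h.out
  intro t ht
  obtain ⟨j, rfl⟩ := exists_get_of_mem ht
  have h16 := CubeNB.vol_add_sum_AC_BC_le hS (fun i => (hc i).1) (fun i => (hc i).2.1) j
  have e : ∀ i, (#(A i) + #(B i)) * #(C i) = qc (P.get i) := fun i => by
    rw [(hc i).2.2.2.1, (hc i).2.2.2.2.1, (hc i).2.2.2.2.2]; rfl
  simp only [e] at h16
  rw [(hc j).2.2.2.1, (hc j).2.2.2.2.1, (hc j).2.2.2.2.2] at h16
  have := sum_erase_get P qc j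
  change (P.get j).1 * (P.get j).2.1 * (P.get j).2.2 + _ ≤ _ at h16
  simp only [svol]
  omega

/-- `vol t + Σ qa ≤ |H| + qa t` for every block `t` (`A`-reading). [cite: CohnKleinbergSzegedyUmans2005, Def. 5.1] -/
theorem n16_a (h : Realizable H P) : ∀ t ∈ P, svol t + (P.map qa).sum ≤ Fintype.card H + qa t := by
  classical
  obtain ⟨A, B, C, hS, hc⟩ := h.out
  intro t ht
  obtain ⟨j, rfl⟩ := exists_get_of_mem ht
  have h16 := CubeNB.vol_add_sum_AB_AC_le hS (fun i => (hc i).2.1) (fun i => (hc i).2.2.1) j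
  have e : ∀ i, #(A i) * (#(B i) + #(C i)) = qa (P.get i) := fun i => by
    rw [(hc i).2.2.2.1, (hc i).2.2.2.2.1, (hc i).2.2.2.2.2]; rfl
  simp only [e] at h16
  rw [(hc j).2.2.2.1, (hc j).2.2.2.2.1, (hc j).2.2.2.2.2] at h16
  have := sum_erase_get P qa j
  change (P.get j).1 * (P.get j).2.1 * (P.get j).2.2 + _ ≤ _ at h16
  simp only [svol]
  omega

/-- `vol t + Σ qb ≤ |H| + qb t` for every block `t` (`B`-reading). [cite: CohnKleinbergSzegedyUmans2005, Def. 5.1] -/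
theorem n16_b (h : Realizable H P) : ∀ t ∈ P, svol t + (P.map qb).sum ≤ Fintype.card H + qb t := by
  classical
  obtain ⟨A, B, C, hS, hc⟩ := h.out
  intro t ht
  obtain ⟨j, rfl⟩ := exists_get_of_mem ht
  have h16 := CubeNB.vol_add_sum_AB_BC_le hS (fun i => (hc i).2.2.1) (fun i => (hc i).1) j
  have e : ∀ i, #(B i) * (#(A i) + #(C i)) = qb (P.get i) := fun i => by
    rw [(hc i).2.2.2.1, (hc i).2.2.2.2.1, (hc i).2.2.2.2.2]; rfl
  simp only [e] at h16
  rw [(hc j).2.2.2.1, (hc j).2.2.2.2.1, (hc j).2.2.2.2.2] at h16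
  have := sum_erase_get P qb j
  change (P.get j).1 * (P.get j).2.1 * (P.get j).2.2 + _ ≤ _ at h16
  simp only [svol]
  omega

/-! ## N7, the rank law with the best direction per block -/

/-- The direction realising the largest flattening. [folklore] -/
def dirOf (s : Shape) : Fin 3 := if pbc s ≤ pab s ∧ pca s ≤ pab s then 1 else if pca s ≤ pbc s then 2 else 0

/-- The gain of the best direction is `maxflat`. [folklore] -/
theorem gain_dirOf (s : Shape) : gain (dirOf s) s.1 s.2.1 s.2.2 = maxflat s := by
  obtain ⟨a, b, c⟩ := s
  simp only [dirOf, maxflat, pab, pbc, pca]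
  by_cases h1 : b * c ≤ a * b ∧ a * c ≤ a * b
  · rw [if_pos h1]
    simp only [gain, Fin.isValue, one_ne_zero, ↓reduceIte]
    omega
  · rw [if_neg h1]
    by_cases h2 : a * c ≤ b * c
    · rw [if_pos h2]
      simp only [gain, Fin.isValue, show (2 : Fin 3) ≠ 0 from by decide, show (2 : Fin 3) ≠ 1 from by decide, ↓reduceIte]
      omega
    · rw [if_neg h2]
      simp only [gain, Fin.isValue, ↓reduceIte]
      omega

/-- `Σ maxflat ≤ |H|` (N7, pure form). [cite: CohnKleinbergSzegedyUmans2005, Thm. 5.5] [cite: BuczynskiPostinghelRupniewski2020, §3.1 (first Lemma)] -/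
theorem sum_maxflat_le (h : Realizable H P) : (P.map maxflat).sum ≤ Fintype.card H := by
  classical
  obtain ⟨A, B, C, hS, hc⟩ := h.out
  have h7 := sum_gain_le_card_of_isSTPP A B C hS (fun i => ⟨(hc i).1, (hc i).2.1, (hc i).2.2.1⟩) (fun i => dirOf (P.get i))
  have e : ∀ i, gain (dirOf (P.get i)) (A i).card (B i).card (C i).card = maxflat (P.get i) := fun i => by
    rw [(hc i).2.2.2.1, (hc i).2.2.2.2.1, (hc i).2.2.2.2.2]; exact gain_dirOf _
  simp only [e] at h7
  rwa [sum_get] at h7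

/-- `rlbPaper t + Σ maxflat ≤ |H| + maxflat t` for every block `t` (N7 at a distinguished block). [cite: CohnKleinbergSzegedyUmans2005, Thm. 5.5]
[cite: BuczynskiPostinghelRupniewski2020, §3.1 (first Lemma)] -/
theorem rlb_add_sum_maxflat_le (h : Realizable H P) : ∀ t ∈ P, rlb t + (P.map maxflat).sum ≤ Fintype.card H + maxflat t := by
  classical
  obtain ⟨A, B, C, hS, hc⟩ := h.out
  intro t ht
  obtain ⟨j, rfl⟩ := exists_get_of_mem ht
  have h7 := rlbPaper_add_sum_gain_le_card_of_isSTPP A B C hS (fun i => ⟨(hc i).1, (hc i).2.1, (hc i).2.2.1⟩) (fun i => dirOf (P.get i)) j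
  have e : ∀ i, gain (dirOf (P.get i)) (A i).card (B i).card (C i).card = maxflat (P.get i) := fun i => by
    rw [(hc i).2.2.2.1, (hc i).2.2.2.2.1, (hc i).2.2.2.2.2]; exact gain_dirOf _
  simp only [e] at h7
  rw [(hc j).2.2.2.1, (hc j).2.2.2.2.1, (hc j).2.2.2.2.2] at h7
  have := sum_erase_get P maxflat j
  change rlb (P.get j) + _ ≤ _ at h7
  omega

end Realizable

end Summit.MatrixMultiplication.OmegaCensus.KLister
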